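/-
Copyright: the b2b-balaban cell (near-miss cell 7), T⁴-continuum fan-out, lineage t4-ne7b-p3 (node U5c LARGE-DEVIATION
member P3).  Released under the licence of the surrounding project.
-/
import Summits.QuantumFields.BalabanUV.T4Continuum.Support.SpaceTimePeierlsLeaves

/-!
# Space-time Peierls ∕ Cramér route for NE7b — leaf A3 ASSEMBLED from its halves: the pinned-contour bound from
# «factor of the pinned lineage» × «resummed remainder» (skeleton row ST9)

Summits-side support leaf of the T⁴-continuum cell (rung (B)+1 on a FINITE torus only; NOT infinite volume, NOT the
mass gap, NOT the Clay statement; NOT a proof of the spine estimate NE7b).  Lineage `t4-ne7b-p3` (generation 1), node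
U5c, skeleton `t4/skeletons/NE7b-t4-ne7b-p3.md` v1.2 leaf A3 (sub-leaves A3a–A3f), row ST9.  [folklore] real arithmetic
over the abstract carrier `SpaceTimePeierlsLeaves.OccModel`; nothing is quoted from print and nothing printed is
asserted; no `[cite:]` tag.

WHAT.  Leaf A3 (`OccModel.PinnedContourBound M A q nup`: the terms having a given contour `𝒦` weigh
`≤ q^{#𝒦}·nup`) is the product of two halves of different TYPE, and this file types the split and proves the product:
* the FACTOR half (A3a κ-balance ∧ A3b′ volume ∧ A3c income ∧ A3d banking, junction `SpaceTimeLedgerMaint` /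
  `SpaceTimeBanking`): every term pinned by `𝒦` is at most `q₀^{#𝒦}` times a nonnegative REMAINDER weight `rest τ`
  (the term with the pinned lineage's large-field factor `e^{−(income − maint)} ≤ q₀^{#𝒦}` pulled out);
* the REMAINDER half (A3e resummation over the (B)-upper machinery ∧ A3f history multiplicity): the remainders of the
  terms pinned by `𝒦` sum to at most `m^{#𝒦} · nup` (multiplicity `m = e^{c₃}` per cell × the envelope).
`structure PinnedSplit` displays the two halves as binders; `pinnedContourBound_of_split` proves
`PinnedContourBound M A (q₀·m) nup`.  Both halves stay hypotheses (the factor half is kernel modulo the (ID) reading and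
the doubled printed thresholds; the remainder half is the node's pinning junction over (B), NOT PRINTED as a statement).

HONEST DEPENDENCY (cell, verbatim): continuum YM on T⁴ ⇐ BetaPertH ∧ nine spine estimates (0/9 proved); BetaPertH ⇐
(D1) ∧ (D4) ∧ CAP+tail; G-an2-4 gates asym, D1 and NE2/3/4.  This file changes none of it.
-/

open Finset

namespace Summit.QuantumFields.BalabanUV.T4Continuum.SpaceTimePeierlsLeaves

variable {ι Cell : Type*}

open Classical in
/-- NAMED SHAPE `PinnedSplit M A rest q₀ m nup` (ONE run, ONE `(K, t)`): for every cell set `𝒦` — (FACTOR) each term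
having `𝒦` as a contour weighs at most `q₀^{#𝒦} · rest τ` with `rest τ ≥ 0` (the pinned lineage's banked factor
pulled out: A3a ∧ A3b′ ∧ A3c ∧ A3d); (REMAINDER) `Σ_{τ pinned by 𝒦} rest τ ≤ m^{#𝒦} · nup` (A3f multiplicity × A3e
envelope).  A hypothesis shape; nothing asserted. [folklore] -/
structure OccModel.PinnedSplit (M : OccModel ι Cell) (A rest : ι → ℝ) (q₀ m nup : ℝ) : Prop where
  /-- the remainder weights are nonnegative -/
  rest_nonneg : ∀ τ ∈ M.T, 0 ≤ rest τ
  /-- FACTOR half: the pinned lineage's factor is at most `q₀^{#𝒦}` -/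
  factor : ∀ (𝒦 : Finset Cell), ∀ τ ∈ M.T, M.IsContour τ 𝒦 → A τ ≤ q₀ ^ 𝒦.card * rest τ
  /-- REMAINDER half: multiplicity × envelope -/
  remainder : ∀ (𝒦 : Finset Cell), ∑ τ ∈ M.T.filter (fun τ => M.IsContour τ 𝒦), rest τ ≤ m ^ 𝒦.card * nup

open Classical in
/-- **A3 FROM ITS HALVES**: `PinnedSplit M A rest q₀ m nup` with `q₀ ≥ 0` gives `PinnedContourBound M A (q₀·m) nup`:
`Σ_{pinned} A ≤ q₀^{#𝒦}·Σ_{pinned} rest ≤ q₀^{#𝒦}·m^{#𝒦}·nup = (q₀ m)^{#𝒦}·nup`. [folklore] -/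
theorem OccModel.pinnedContourBound_of_split {M : OccModel ι Cell} {A rest : ι → ℝ} {q₀ m nup : ℝ}
    (h : M.PinnedSplit A rest q₀ m nup) (hq₀ : 0 ≤ q₀) : M.PinnedContourBound A (q₀ * m) nup := by
  intro 𝒦
  calc ∑ τ ∈ M.T.filter (fun τ => M.IsContour τ 𝒦), A τ
      ≤ ∑ τ ∈ M.T.filter (fun τ => M.IsContour τ 𝒦), q₀ ^ 𝒦.card * rest τ :=
        sum_le_sum fun τ hτ => h.factor 𝒦 τ (mem_filter.1 hτ).1 (mem_filter.1 hτ).2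
    _ = q₀ ^ 𝒦.card * ∑ τ ∈ M.T.filter (fun τ => M.IsContour τ 𝒦), rest τ := by rw [mul_sum]
    _ ≤ q₀ ^ 𝒦.card * (m ^ 𝒦.card * nup) := mul_le_mul_of_nonneg_left (h.remainder 𝒦) (pow_nonneg hq₀ _)
    _ = (q₀ * m) ^ 𝒦.card * nup := by rw [mul_pow]; ring

/-- The factor half from a PER-TERM SURPLUS: if each pinned term weighs at most `e^{−S τ} · rest τ` with a surplus
`S τ ≥ s · #𝒦` (the rate form of `ContourLedger.surplus_ge_rateM_mul_vol` for the lineage's ledger,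
`vol = #𝒦`),
then the factor binder holds with `q₀ = e^{−s}`. [folklore] -/
theorem factor_of_surplus {M : OccModel ι Cell} {A rest S : ι → ℝ} {s : ℝ}
    (hrest : ∀ τ ∈ M.T, 0 ≤ rest τ)
    (hA : ∀ (𝒦 : Finset Cell), ∀ τ ∈ M.T, M.IsContour τ 𝒦 → A τ ≤ Real.exp (-S τ) * rest τ)
    (hS : ∀ (𝒦 : Finset Cell), ∀ τ ∈ M.T, M.IsContour τ 𝒦 → s * 𝒦.card ≤ S τ) :
    ∀ (𝒦 : Finset Cell), ∀ τ ∈ M.T, M.IsContour τ 𝒦 → A τ ≤ Real.exp (-s) ^ 𝒦.card * rest τ := by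
  intro 𝒦 τ hτ hc
  refine (hA 𝒦 τ hτ hc).trans (mul_le_mul_of_nonneg_right ?_ (hrest τ hτ))
  rw [← Real.exp_nat_mul, Real.exp_le_exp]
  have := hS 𝒦 τ hτ hc
  linarith

end Summit.QuantumFields.BalabanUV.T4Continuum.SpaceTimePeierlsLeaves
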